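import Literature.Topology.FourManifolds.SmoothOrientationProofs
import Literature.Topology.FourManifolds.SmoothOrientationDiffeomorphProofs
import Mathlib.Topology.Instances.Matrix
import Mathlib.Topology.Connected.TotallyDisconnected
import HarnessLib

/-!
# The orientation sign of a moving frame

Topic `Literature/Topology/FourManifolds`; infrastructure for the named fact
`Literature.Topology.FourManifolds.exists_isCircleSurgery` (`CircleSurgery.lean`), whose only
missing input is the triviality of the normal bundle of an embedded circle in an *orientable*
4-manifold (`Literature.Topology.FourManifolds.nonempty_circleNbhd`). Orientability enters the
classical proof (Hirsch, *Differential Topology* (1976), Ch. 4 §4, Lemma 4.1 and Exercise 2;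
Kosinski, *Differential Manifolds* (1993), VI.6: "the only orientable disc bundle over the circle
is the product bundle") through one elementary principle, proved here for the tree's
`Literature.Topology.FourManifolds.SmoothOrientation` (a locally constant family of orientations
of the tangent spaces, read in the preferred charts):

*the orientation character of a continuously moving frame along a connected parameter set is
constant.*

* `Literature.Topology.FourManifolds.SmoothOrientation.sign o x ∈ {1, -1}`: the orientation
  `o x` of `T_x M` compared with the reference basis `Module.finBasis ℝ E` of the model space;
  `Literature.Topology.FourManifolds.SmoothOrientation.IsPosFrame o x v`: the frame
  `v : Fin (finrank E) → E` of `T_x M` (read in the preferred chart at `x`) is positively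
  oriented, i.e. `0 < sign o x * det v`; for a basis this is `v.orientation = o x`
  (`isPosFrame_iff_orientation_eq`).
* `Literature.Topology.FourManifolds.SmoothOrientation.eventually_isPosFrame_iff` — **transport**:
  for `y` near `x`, a frame at `y` is positive iff its reading in the chart at `x` (through the
  derivative `tangentCoordChange I y x y` of the chart change) is positive at `x`.
* `Literature.Topology.FourManifolds.SmoothOrientation.isPosFrame_iff_of_isPreconnected` —
  **constancy**: along a map `γ : Y → M`, continuous on a preconnected set `S`, a frame `B y` of
  `T_{γ y} M` which is continuous when read in every chart and nowhere degenerate has constant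
  orientation character on `S`.
* `det_neg_last`-type bookkeeping: reversing one vector of a frame reverses its character
  (`isPosFrame_update_neg_iff`), and linearly independent frames are non-degenerate
  (`det_ne_zero_of_linearIndependent`).

Everything here is proved; no named facts are introduced.

## References

* M. W. Hirsch, *Differential Topology*, GTM 33 (1976), Ch. 4 §4 (orientations as locally
  constant families of orientations of the fibres; Lemma 4.1, Exercise 2). [HirschDT1976]
* A. A. Kosinski, *Differential Manifolds* (1993), VI.6, before Cor. 6.6. [Kosinski1993]
-/

open scoped Manifold Topology
open Set Module Function Filter

noncomputable section

namespace Literature.Topology.FourManifolds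

/-! ### Determinants of frames with respect to a basis: continuity and elementary rules -/

section BasisDet

variable {E : Type*} [NormedAddCommGroup E] [NormedSpace ℝ E] [FiniteDimensional ℝ E]
  {ι : Type*} [Fintype ι] [DecidableEq ι]

/-- The determinant of a frame with respect to a fixed basis of a finite-dimensional real normed
space depends continuously on the frame (it is a polynomial in the coordinates). [folklore] -/
theorem continuous_basis_det (b : Basis ι ℝ E) : Continuous fun v : ι → E => b.det v := by
  have h : (fun v : ι → E => b.det v) = fun v => (b.toMatrix v).det := by
    funext v
    exact b.det_apply v
  rw [h]
  refine Continuous.matrix_det ?_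
  refine continuous_matrix fun i j => ?_
  have h2 : (fun v : ι → E => b.toMatrix v i j) = fun v => b.coord i (v j) := by
    funext v
    rw [Basis.toMatrix_apply]
    rfl
  rw [h2]
  exact (b.coord i).continuous_of_finiteDimensional.comp (continuous_apply j)

omit [FiniteDimensional ℝ E] in
/-- Composing a frame with a linear endomorphism multiplies its determinant by the determinant
of the endomorphism. [folklore] -/
theorem basis_det_clm_apply (b : Basis ι ℝ E) (T : E →L[ℝ] E) (v : ι → E) :
    b.det (fun i => T (v i)) = LinearMap.det (T : E →ₗ[ℝ] E) * b.det v := by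
  have : (fun i => T (v i)) = (T : E →ₗ[ℝ] E) ∘ v := rfl
  rw [this, Basis.det_comp]

omit [FiniteDimensional ℝ E] in
/-- Reversing one vector of a frame reverses the sign of its determinant. [folklore] -/
theorem basis_det_update_neg (b : Basis ι ℝ E) (v : ι → E) (i : ι) :
    b.det (update v i (-v i)) = -b.det v := by
  rw [b.det.map_update_neg, update_eq_self]

/-- A linearly independent frame indexed by `Fin (finrank E)` has non-zero determinant (it is a
basis). [folklore] -/
theorem det_ne_zero_of_linearIndependent (b : Basis (Fin (finrank ℝ E)) ℝ E)
    {v : Fin (finrank ℝ E) → E} (hv : LinearIndependent ℝ v) : b.det v ≠ 0 := by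
  have hspan : Submodule.span ℝ (range v) = ⊤ :=
    hv.span_eq_top_of_card_eq_finrank' (Fintype.card_fin _)
  exact ((Module.Basis.is_basis_iff_det b).1 ⟨hv, hspan⟩).ne_zero

end BasisDet

/-! ### The orientation sign and positive frames -/

namespace SmoothOrientation

variable {E H : Type*} [NormedAddCommGroup E] [NormedSpace ℝ E] [FiniteDimensional ℝ E]
  [TopologicalSpace H] {I : ModelWithCorners ℝ E H}
  {M : Type*} [TopologicalSpace M] [ChartedSpace H M] [IsManifold I 1 M]

/-- The **sign of an orientation** of `T_x M` relative to the reference basis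
`Module.finBasis ℝ E` of the model space: `1` if `o x` is the orientation of the reference basis,
`-1` otherwise (Hirsch, *Differential Topology* (1976), Ch. 4 §4: each fibre has exactly two
orientations). [folklore] -/
def sign (o : SmoothOrientation I M) (x : M) : ℝ :=
  haveI := Classical.dec (o x = (finBasis ℝ E).orientation)
  if o x = (finBasis ℝ E).orientation then 1 else -1

/-- A frame `v` of `T_x M` (vectors read in the preferred chart at `x`, indexed by
`Fin (finrank E)`) is **positively oriented** for `o` at `x`: its determinant with respect to
the reference basis has the sign `sign o x` (for a basis: `v.orientation = o x`,
`isPosFrame_iff_orientation_eq`; Hirsch (1976), Ch. 4 §4). [folklore] -/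
def IsPosFrame (o : SmoothOrientation I M) (x : M) (v : Fin (finrank ℝ E) → E) : Prop :=
  0 < o.sign x * (finBasis ℝ E).det v

/-- The orientation sign is `1` or `-1`. [folklore] -/
theorem sign_eq_one_or (o : SmoothOrientation I M) (x : M) : o.sign x = 1 ∨ o.sign x = -1 := by
  unfold sign
  split_ifs
  · exact Or.inl rfl
  · exact Or.inr rfl

/-- The orientation sign does not vanish. [folklore] -/
theorem sign_ne_zero (o : SmoothOrientation I M) (x : M) : o.sign x ≠ 0 := by
  rcases o.sign_eq_one_or x with h | h <;> rw [h] <;> norm_num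

/-- The orientation sign squares to one. [folklore] -/
theorem sign_mul_self (o : SmoothOrientation I M) (x : M) : o.sign x * o.sign x = 1 := by
  rcases o.sign_eq_one_or x with h | h <;> rw [h] <;> norm_num

/-- **Positive frames are the bases of orientation `o x`.** [folklore] -/
theorem isPosFrame_iff_orientation_eq (o : SmoothOrientation I M) (x : M)
    (v : Basis (Fin (finrank ℝ E)) ℝ E) : o.IsPosFrame x v ↔ v.orientation = o x := by
  unfold IsPosFrame sign
  have hdet : (finBasis ℝ E).det v ≠ 0 := ((finBasis ℝ E).isUnit_det v).ne_zero
  have key : (finBasis ℝ E).orientation = v.orientation ↔ 0 < (finBasis ℝ E).det v :=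
    (finBasis ℝ E).orientation_eq_iff_det_pos v
  split_ifs with h
  · rw [one_mul, ← key, h]
    exact eq_comm
  · rw [neg_one_mul, neg_pos]
    have h' : o x = -(finBasis ℝ E).orientation :=
      ((finBasis ℝ E).orientation_ne_iff_eq_neg (o x)).1 h
    constructor
    · intro hlt
      have hne : (finBasis ℝ E).orientation ≠ v.orientation := fun heq => by
        rw [key] at heq
        exact lt_asymm hlt heq
      rw [h']
      have := ((finBasis ℝ E).orientation_ne_iff_eq_neg v.orientation).1 (Ne.symm hne)
      rw [this]
    · intro hv
      have hne : (finBasis ℝ E).orientation ≠ v.orientation := by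
        intro heq
        rw [heq, hv] at h'
        exact Module.Ray.ne_neg_self (o x) h'
      rcases hdet.lt_or_gt with hlt | hgt
      · exact hlt
      · exact absurd (key.2 hgt) hne

/-- A positive frame is non-degenerate. [folklore] -/
theorem IsPosFrame.det_ne_zero {o : SmoothOrientation I M} {x : M} {v : Fin (finrank ℝ E) → E}
    (h : o.IsPosFrame x v) : (finBasis ℝ E).det v ≠ 0 := by
  intro h0
  rw [IsPosFrame, h0, mul_zero] at h
  exact lt_irrefl 0 h

/-- For a non-degenerate frame, *not positive* means *negative*. [folklore] -/
theorem not_isPosFrame_iff (o : SmoothOrientation I M) (x : M) {v : Fin (finrank ℝ E) → E}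
    (hv : (finBasis ℝ E).det v ≠ 0) : ¬o.IsPosFrame x v ↔ o.sign x * (finBasis ℝ E).det v < 0 := by
  rw [IsPosFrame, not_lt]
  exact ⟨fun h => lt_of_le_of_ne h (mul_ne_zero (o.sign_ne_zero x) hv), le_of_lt⟩

/-- **Reversing one vector of a non-degenerate frame reverses its orientation character.**
[folklore] -/
theorem isPosFrame_update_neg_iff (o : SmoothOrientation I M) (x : M)
    {v : Fin (finrank ℝ E) → E} (hv : (finBasis ℝ E).det v ≠ 0) (i : Fin (finrank ℝ E)) :
    o.IsPosFrame x (update v i (-v i)) ↔ ¬o.IsPosFrame x v := by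
  rw [o.not_isPosFrame_iff x hv, IsPosFrame, basis_det_update_neg, mul_neg, neg_pos]

/-- Two frames which agree except that one vector is reversed have opposite orientation
characters. [folklore] -/
theorem isPosFrame_iff_not_of_eq_neg (o : SmoothOrientation I M) (x : M)
    {v w : Fin (finrank ℝ E) → E} (hv : (finBasis ℝ E).det v ≠ 0) (i : Fin (finrank ℝ E))
    (hi : w i = -v i) (hne : ∀ j, j ≠ i → w j = v j) :
    o.IsPosFrame x w ↔ ¬o.IsPosFrame x v := by
  have : w = update v i (-v i) := by
    funext j
    by_cases hj : j = i
    · subst hj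
      rw [update_self, hi]
    · rw [update_of_ne hj, hne j hj]
  rw [this]
  exact o.isPosFrame_update_neg_iff x hv i

/-- **Transport of the orientation character along a chart change.** For `y` near `x`, a frame
`v` of `T_y M` is positive at `y` iff its reading `tangentCoordChange I y x y ∘ v` in the chart
at `x` is positive at `x`: this is the local constancy of `o` (`SmoothOrientation.eventually_eq_iff`:
`o y = o x` iff the chart change has positive Jacobian) combined with the multiplicativity of
determinants (Hirsch, *Differential Topology* (1976), Ch. 4 §4). [folklore] -/
theorem eventually_isPosFrame_iff (o : SmoothOrientation I M) (x : M) :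
    ∀ᶠ y in 𝓝 x, ∀ v : Fin (finrank ℝ E) → E,
      o.IsPosFrame y v ↔ o.IsPosFrame x (fun i => tangentCoordChange I y x y (v i)) := by
  have hsrc : ∀ᶠ y in 𝓝 x, y ∈ (extChartAt I x).source := extChartAt_source_mem_nhds x
  filter_upwards [o.eventually_eq_iff x, hsrc] with y hy hyx v
  set T : E →L[ℝ] E := tangentCoordChange I y x y with hT
  have hdT : LinearMap.det (T : E →ₗ[ℝ] E) ≠ 0 :=
    det_tangentCoordChange_ne_zero ⟨mem_extChartAt_source y, hyx⟩
  have hdet : (finBasis ℝ E).det (fun i => T (v i)) =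
      LinearMap.det (T : E →ₗ[ℝ] E) * (finBasis ℝ E).det v := basis_det_clm_apply _ T v
  -- the sign relation between `o y` and `o x`
  have hsign : o.sign y = o.sign x * (if 0 < LinearMap.det (T : E →ₗ[ℝ] E) then 1 else -1) := by
    by_cases hpos : 0 < LinearMap.det (T : E →ₗ[ℝ] E)
    · rw [if_pos hpos, mul_one, sign, sign, hy.2 hpos]
    · rw [if_neg hpos, mul_neg, mul_one]
      have hne : o y ≠ o x := fun h => hpos (hy.1 h)
      have hneg : o y = -o x := (orientation_eq_or_eq_neg (o y) (o x)).resolve_left hne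
      unfold sign
      by_cases hx : o x = (finBasis ℝ E).orientation
      · rw [if_pos hx, if_neg]
        rw [hneg, hx]
        exact (Module.Ray.ne_neg_self (finBasis ℝ E).orientation).symm
      · rw [if_neg hx, _root_.neg_neg, if_pos]
        rw [hneg, ((finBasis ℝ E).orientation_ne_iff_eq_neg (o x)).1 hx]
        exact _root_.neg_neg ((finBasis ℝ E).orientation : Orientation ℝ E (Fin (finrank ℝ E)))
  unfold IsPosFrame
  rw [hdet, hsign]
  by_cases hpos : 0 < LinearMap.det (T : E →ₗ[ℝ] E)
  · rw [if_pos hpos, mul_one,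
      show o.sign x * (LinearMap.det (T : E →ₗ[ℝ] E) * (finBasis ℝ E).det v) =
        LinearMap.det (T : E →ₗ[ℝ] E) * (o.sign x * (finBasis ℝ E).det v) by ring]
    exact (mul_pos_iff_of_pos_left hpos).symm
  · have hneg : LinearMap.det (T : E →ₗ[ℝ] E) < 0 := lt_of_le_of_ne (not_lt.1 hpos) hdT
    rw [if_neg hpos,
      show o.sign x * (LinearMap.det (T : E →ₗ[ℝ] E) * (finBasis ℝ E).det v) =
        -LinearMap.det (T : E →ₗ[ℝ] E) * (o.sign x * -1 * (finBasis ℝ E).det v) by ring]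
    exact (mul_pos_iff_of_pos_left (neg_pos.2 hneg)).symm

/-- **The orientation character of a moving frame is constant along connected parameter sets.**
Let `γ : Y → M` be continuous on a preconnected set `S` and `B y` a frame of `T_{γ y} M`
(read in the preferred chart at `γ y`) which is non-degenerate on `S` and *continuous in charts*:
for every `p : M`, the reading `y ↦ tangentCoordChange I (γ y) p (γ y) ∘ B y` is continuous on
`S ∩ γ ⁻¹' (chart domain of p)`. Then `B y` is positively oriented for `o` either at every
`y ∈ S` or at no `y ∈ S` (Hirsch, *Differential Topology* (1976), Ch. 4 §4: an orientation of a
bundle is a locally constant, hence on connected sets constant, choice of orientations of the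
fibres). [folklore] -/
theorem isPosFrame_iff_of_isPreconnected (o : SmoothOrientation I M) {Y : Type*}
    [TopologicalSpace Y] {S : Set Y} (hS : IsPreconnected S) {γ : Y → M}
    {B : Y → Fin (finrank ℝ E) → E} (hγ : ContinuousOn γ S)
    (hB : ∀ p : M, ContinuousOn (fun y i => tangentCoordChange I (γ y) p (γ y) (B y i))
      (S ∩ γ ⁻¹' (chartAt H p).source))
    (hdet : ∀ y ∈ S, (finBasis ℝ E).det (B y) ≠ 0) {y y' : Y} (hy : y ∈ S) (hy' : y' ∈ S) :
    o.IsPosFrame (γ y) (B y) ↔ o.IsPosFrame (γ y') (B y') := by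
  classical
  -- the character as a `Bool`-valued function, continuous on `S`
  let f : Y → Bool := fun y => decide (o.IsPosFrame (γ y) (B y))
  suffices hf : ContinuousOn f S by
    have := hS.constant hf hy hy'
    simpa [f] using this
  intro y₀ hy₀
  set x := γ y₀ with hx
  -- transport to the chart at `x`, along `γ`
  have h1 : ∀ᶠ y in 𝓝[S] y₀, ∀ v : Fin (finrank ℝ E) → E,
      o.IsPosFrame (γ y) v ↔ o.IsPosFrame x (fun i => tangentCoordChange I (γ y) x (γ y) (v i)) :=
    (hγ y₀ hy₀).eventually (o.eventually_isPosFrame_iff x)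
  have h2 : ∀ᶠ y in 𝓝[S] y₀, γ y ∈ (chartAt H x).source :=
    (hγ y₀ hy₀).eventually ((chartAt H x).open_source.mem_nhds (mem_chart_source H x))
  -- continuity of the determinant of the reading at `x`
  set g : Y → ℝ := fun y => (finBasis ℝ E).det fun i => tangentCoordChange I (γ y) x (γ y) (B y i)
    with hg
  have hg_cont : ContinuousWithinAt g S y₀ := by
    have hmem : S ∩ γ ⁻¹' (chartAt H x).source ∈ 𝓝[S] y₀ :=
      inter_mem self_mem_nhdsWithin h2
    have h3 : ContinuousWithinAt (fun y i => tangentCoordChange I (γ y) x (γ y) (B y i))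
        (S ∩ γ ⁻¹' (chartAt H x).source) y₀ := hB x y₀ ⟨hy₀, mem_chart_source H x⟩
    exact ((continuous_basis_det (finBasis ℝ E)).continuousAt.comp_continuousWithinAt
      h3).mono_of_mem_nhdsWithin hmem
  have hg0 : g y₀ ≠ 0 := by
    simp only [hg]
    rw [basis_det_clm_apply]
    refine mul_ne_zero (det_tangentCoordChange_ne_zero ⟨mem_extChartAt_source _, ?_⟩) (hdet y₀ hy₀)
    rw [extChartAt_source]
    exact mem_chart_source H x
  -- the sign of `sign o x * g` is eventually constant near `y₀` within `S`
  have h4 : ∀ᶠ y in 𝓝[S] y₀, (0 < o.sign x * g y ↔ 0 < o.sign x * g y₀) := by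
    have hc : ContinuousWithinAt (fun y => o.sign x * g y) S y₀ :=
      continuousWithinAt_const.mul hg_cont
    rcases (mul_ne_zero (o.sign_ne_zero x) hg0).lt_or_gt with hlt | hgt
    · filter_upwards [hc.eventually (eventually_lt_nhds hlt)] with y hy
      exact iff_of_false (lt_asymm hy) (lt_asymm hlt)
    · filter_upwards [hc.eventually (eventually_gt_nhds hgt)] with y hy
      exact iff_of_true hy hgt
  -- conclusion: `f` is eventually constant within `S`
  have h5 : ∀ᶠ y in 𝓝[S] y₀, f y = f y₀ := by
    have h1' := h1.self_of_nhdsWithin hy₀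
    filter_upwards [h1, h4] with y hy1 hy4
    simp only [f]
    have e1 : o.IsPosFrame (γ y) (B y) ↔ o.IsPosFrame (γ y₀) (B y₀) := by
      rw [hy1 (B y), h1' (B y₀)]
      exact hy4
    by_cases hP : o.IsPosFrame (γ y₀) (B y₀)
    · rw [decide_eq_true (e1.2 hP), decide_eq_true hP]
    · rw [decide_eq_false (fun h => hP (e1.1 h)), decide_eq_false hP]
  exact (continuousWithinAt_const (b := f y₀)).congr_of_eventuallyEq h5 rfl

end SmoothOrientation

end Literature.Topology.FourManifolds
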